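import Literature.MathematicalPhysics.QuantumLattice.SymmetricRegimeFunctionals
import Literature.MathematicalPhysics.QuantumLattice.HubbardEffectiveActionCT
import HarnessLib

/-!
# The symmetric-regime certificate of the countertermed Hubbard effective action

Topic `Literature/MathematicalPhysics/QuantumLattice`; the MODEL BINDING of the definition request
`defn-symmetricRegimeCertificate` (D1′b of route HubbardSuperconductivity/AposterioriCapRg rev 12; it
types the producer crux `CapRgSymmetricCertificateCT` = stmt-13959 and the hypothesis of the consumer
crux `SeededBrokenRegimeBoseFermiCT` = stmt-13960).  All functionals, the two rational records
`SymmetricRegimeData` (`π`) / `SymmetricAccuracy` (`Θ`) and the clause-by-clause predicate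
`SymmetricCertifiedAt` / `SymmetricRegimeHolds` live in `SymmetricRegimeFunctionals.lean` (ONE
normalisation, documented there); this file plugs in the countertermed frame of
`HubbardEffectiveActionCT.lean` (D1′a):

  `symmetricRegimeCertificate U μ π Θ K Λ L₀ :=`
  `  SymmetricRegimeHolds π Θ (K.coeffNorm 6) (e^c_K) Λ L₀ (e_K) (𝒢^K_Λ at h = 0) (Z^K_Λ at h = 0)`,

i.e.: the frame `K : TrigPolyC4v` is admissible for `π` (`Σ_{m,n} (1+m+n)^6 |κ_{m,n}| ≤ κ_max`,
`TrigPolyC4v.coeffNorm`), `Λ ∈ [Λ₁, Λ₂]`, the continuum renormalised band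
`e^c_K(p) = -2(cos p₁ + cos p₂) - μ - K(p)` (`renormalisedBandC`; on the lattice momenta it IS
`nambuXiCT L μ K`, `renormalisedBandC_latticeMomentum`) has the shell geometry of `π` on
`{|e^c_K| ≤ Λ}` (clause (0d)), and for all `L ≥ L₀` there is `β₀` with, for all `β ≥ β₀`, an `M₀` with,
for all `M ≥ M₀`, `SymmetricCertifiedAt π Θ Λ L M β (nambuXiCT L μ K)
(hubbardEffectiveActionCT L M β U μ 0 K Λ) (hubbardEffPartitionFnCT L M β U μ 0 K Λ)` — clauses (0a)
`Z ≠ 0`, (0b) Fermi-curve mismatch `≤ c₀Λ`, (0c) field strengths in `[ζ, 1/ζ]` on the shell, (i′)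
`‖𝒱₄‖_∞ ≤ E₁ ∧ ρ_Λ ≤ η₁`, (ii′) `B₁g` Cooper dominance with margin `2` and Stoner products `≤ 1 - σ` at
every transfer momentum, (iii′) an exhibited rational enclosure of `λ_d(Λ)` inside `[1/8, 1/5]` of width
`≤ w`.  With it the planner's cruxes read (REPAIR_13882.md §3–4):
`CapRgSymmetricCertificateCT := ∃ U ∈ Icc 2 3, ∃ δ ∈ Icc (1/5) (7/20), ∃ μ, (density → 1-δ) ∧ ∃ π, ∀ Θ,
∃ K Λ L₀, symmetricRegimeCertificate U μ π Θ K Λ L₀` and `SeededBrokenRegimeBoseFermiCT := ∀ kStar etaStar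
> 0, ∀ π, ∃ Θ, ∀ U ∈ Icc 2 3, ∀ μ K Λ L₀, symmetricRegimeCertificate U μ π Θ K Λ L₀ → …` (positivity of the
entries of `π`, `Θ` is built into the records).

## API (all proved)

`renormalisedBandC_latticeMomentum` (continuum band = `nambuXiCT` on the dual torus),
`renormalisedBandC_neg` (even); unfolding `symmetricRegimeCertificate_iff`; the projections
`symmetricRegimeCertificate.coeffNorm_le`, `.admitsScale`, `.scale_pos`, `.shellGeometry`; monotonicity in
`L₀` (`.mono`); and the requested junk test **`not_symmetricRegimeCertificate_free`**: at `U = 0` (bare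
frame) the certificate is FALSE for every `μ, π, Θ, Λ, L₀` — the effective action vanishes
(`hubbardEffectiveActionCT_free_zero_frame`), so `λ_d = 0 ∉ [1/8, 1/5]`.

## NOT claimed

No instance is asserted (that is crux stmt-13959); nothing about `M → ∞`, `L → ∞` beyond the
quantifiers; the flags on `ρ_Λ` / `η₁` and on the inert width `w` recorded in
`SymmetricRegimeFunctionals.lean` ("What is NOT claimed") apply verbatim.  At `U = 0` in a frame
`K ≠ 0` the action is the resummed quadratic counterterm, whose Cooper matrix vanishes as well; only
the bare-frame case is proved here.

## Sources

As in `SymmetricRegimeFunctionals.lean` and `HubbardEffectiveActionCT.lean`: M. Salmhofer, CMP 194 (1998)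
249, §§3.2, 4.1–4.2, 5.1, 5.3, 6.2, 7 [`Salmhofer1998`]; J. Feldman, M. Salmhofer, E. Trubowitz, J. Stat.
Phys. 84 (1996) 1209 (the counterterm frame) [`FeldmanSalmhoferTrubowitz1996`]; J. Feldman, H. Knörrer,
E. Trubowitz, CMP 247 (2004) 1 [`FeldmanKnorrerTrubowitz2004`]; C. Honerkamp, M. Salmhofer, PRB 64 (2001)
184516, §1 [`HonerkampSalmhofer2001`]; format precedent J.-Ll. Figueras, A. Haro, A. Luque, Found.
Comput. Math. 17 (2017) 1123, Thm 2.5 [`FiguerasHaroLuque2016`]; the object is posited by the route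
(planner evidence REPAIR_13882.md §2).
-/

noncomputable section

namespace Literature.MathematicalPhysics.QuantumLattice

open Literature.Probability.LatticeModels GrassmannAlgebra Finset

/-! ### The continuum renormalised band of a frame -/

/-- The **continuum renormalised band** of the frame `K` at chemical potential `μ`,
`e^c_K(p) = ε(p) - μ - K(p)`, `ε(p) = -2(cos p₁ + cos p₂)` (hopping `t = 1`), a `2π`-periodic smooth
function on `ℝ²` whose values at the lattice momenta `p_k⃗ = 2πk⃗/L` are the renormalised band
`nambuXiCT L μ K` of `HubbardEffectiveActionCT.lean` (FST 1996: `e = E - K`). [cite: FeldmanSalmhoferTrubowitz1996, §1 Discussion (E = e + K)] -/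
def renormalisedBandC (μ : ℝ) (K : TrigPolyC4v) (p : Fin 2 → ℝ) : ℝ :=
  -2 * (Real.cos (p 0) + Real.cos (p 1)) - μ - K.eval p

/-- **On the dual torus the continuum band is the renormalised band `e_K`** of the CT covariance and
cutoff: `e^c_K(p_k⃗) = nambuXiCT L μ K k⃗`. [folklore] -/
theorem renormalisedBandC_latticeMomentum (L : ℕ) (μ : ℝ) (K : TrigPolyC4v) (k : TorusSite 2 L) :
    renormalisedBandC μ K (latticeMomentum L k) = nambuXiCT L μ K k := by
  simp [renormalisedBandC, nambuXiCT, torusBand, Fin.sum_univ_two]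

/-- The continuum band is even, `e^c_K(-p) = e^c_K(p)`. [folklore] -/
theorem renormalisedBandC_neg (μ : ℝ) (K : TrigPolyC4v) (p : Fin 2 → ℝ) :
    renormalisedBandC μ K (-p) = renormalisedBandC μ K p := by
  simp [renormalisedBandC, TrigPolyC4v.eval_neg, Real.cos_neg]

/-! ### The certificate -/

/-- **`symmetricRegimeCertificate U μ π Θ K Λ L₀` — the symmetric-regime (`h = 0`) certificate of the
countertermed Hubbard effective action** (request D1′b of route AposterioriCapRg): the frame `K` is
admissible for the physical data `π` (`K.coeffNorm 6 ≤ κ_max`), `Λ ∈ [Λ₁, Λ₂]`, the continuum shell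
`{|e^c_K| ≤ Λ}` obeys the geometric bounds of `π` (speed, curvature, van Hove distance), and for every
`L ≥ L₀` there is `β₀` such that for every `β ≥ β₀` there is `M₀` such that for every `M ≥ M₀` the
effective action `hubbardEffectiveActionCT L M β U μ 0 K Λ` with normaliser
`hubbardEffPartitionFnCT L M β U μ 0 K Λ` is certified at accuracy `Θ` in the frame `e_K = nambuXiCT L μ K`
(`SymmetricCertifiedAt`: (0a) `Z ≠ 0`, (0b) mismatch `≤ c₀Λ`, (0c) field strengths in `[ζ,1/ζ]`, (i′)
`‖𝒱₄‖_∞ ≤ E₁ ∧ ρ_Λ ≤ η₁`, (ii′) `B₁g` Cooper dominance with margin `2` and Stoner products `≤ 1 - σ` at every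
transfer, (iii′) `λ_d(Λ) ∈ [a,b] ⊆ [1/8,1/5]`, `b - a ≤ w`).  A-posteriori format (Figueras–Haro–Luque
2016, Thm 2.5); the object is posited by the route. [folklore] -/
def symmetricRegimeCertificate (U μ : ℝ) (π : SymmetricRegimeData) (Θ : SymmetricAccuracy)
    (K : TrigPolyC4v) (Λ : ℝ) (L₀ : ℕ) : Prop :=
  SymmetricRegimeHolds π Θ (K.coeffNorm symmetricFrameDecay) (renormalisedBandC μ K) Λ L₀
    (fun L _ => nambuXiCT L μ K)
    (fun L M _ β => hubbardEffectiveActionCT L M β U μ 0 K Λ)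
    (fun L M _ β => hubbardEffPartitionFnCT L M β U μ 0 K Λ)

/-! ### API -/

section API

variable {U μ : ℝ} {π : SymmetricRegimeData} {Θ : SymmetricAccuracy} {K : TrigPolyC4v} {Λ : ℝ} {L₀ : ℕ}

/-- Unfolding `symmetricRegimeCertificate` into its four conjuncts. [folklore] -/
theorem symmetricRegimeCertificate_iff (U μ : ℝ) (π : SymmetricRegimeData) (Θ : SymmetricAccuracy)
    (K : TrigPolyC4v) (Λ : ℝ) (L₀ : ℕ) :
    symmetricRegimeCertificate U μ π Θ K Λ L₀ ↔
      π.AdmitsFrameNorm (K.coeffNorm symmetricFrameDecay) ∧ π.AdmitsScale Λ ∧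
      ShellGeometry (renormalisedBandC μ K) Λ π.velLower π.velUpper π.curvLower π.curvUpper π.vanHoveDist ∧
      ∀ L : ℕ, L₀ ≤ L → ∀ [NeZero L], ∃ β₀ : ℝ, ∀ β : ℝ, β₀ ≤ β → ∃ M₀ : ℕ, ∀ M : ℕ, M₀ ≤ M →
        ∀ [NeZero M], SymmetricCertifiedAt π Θ Λ L M β (nambuXiCT L μ K)
          (hubbardEffectiveActionCT L M β U μ 0 K Λ) (hubbardEffPartitionFnCT L M β U μ 0 K Λ) :=
  Iff.rfl

/-- A certified frame is admissible: `K.coeffNorm 6 ≤ κ_max`. [folklore] -/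
theorem symmetricRegimeCertificate.coeffNorm_le (h : symmetricRegimeCertificate U μ π Θ K Λ L₀) :
    K.coeffNorm symmetricFrameDecay ≤ π.frameBound :=
  h.1

/-- A certified scale is admissible: `Λ ∈ [Λ₁, Λ₂]`. [folklore] -/
theorem symmetricRegimeCertificate.admitsScale (h : symmetricRegimeCertificate U μ π Θ K Λ L₀) :
    π.AdmitsScale Λ :=
  h.2.1

/-- A certified scale is positive. [folklore] -/
theorem symmetricRegimeCertificate.scale_pos (h : symmetricRegimeCertificate U μ π Θ K Λ L₀) : 0 < Λ :=
  h.2.1.pos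

/-- A certified frame has the shell geometry of `π` (clause (0d)). [folklore] -/
theorem symmetricRegimeCertificate.shellGeometry (h : symmetricRegimeCertificate U μ π Θ K Λ L₀) :
    ShellGeometry (renormalisedBandC μ K) Λ π.velLower π.velUpper π.curvLower π.curvUpper π.vanHoveDist :=
  h.2.2.1

/-- Monotonicity in the volume threshold: a certificate from `L₀` on is one from any `L₀' ≥ L₀` on.
[folklore] -/
theorem symmetricRegimeCertificate.mono {L₀' : ℕ} (hL : L₀ ≤ L₀')
    (h : symmetricRegimeCertificate U μ π Θ K Λ L₀) : symmetricRegimeCertificate U μ π Θ K Λ L₀' :=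
  ⟨h.1, h.2.1, h.2.2.1, fun L hL' => h.2.2.2 L (hL.trans hL')⟩

end API

/-! ### The junk test: no certificate at `U = 0` -/

section Free

variable (L M : ℕ) [NeZero L]

/-- **At `U = 0` in the bare frame the effective action vanishes** at every scale: `V_0 = 0`, so
`μ_C ⋆ e^{0} = 1`, `Z = 1`, `𝒢 = -log 1 = 0`. [folklore] -/
theorem hubbardEffectiveActionCT_free_zero_frame (β μ h Λ : ℝ) :
    hubbardEffectiveActionCT L M β 0 μ h 0 Λ = 0 := by
  have hV : hubbardInteractionCT L M β 0 0 = 0 := by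
    rw [hubbardInteractionCT_zero_frame]
    simp [hubbardInteraction]
  have hB : effBoltzmann ℂ (hubbardCovAboveCT L M β μ h 0 Λ) 0 = 1 := by
    rw [effBoltzmann, neg_zero, grassmannExp, IsNilpotent.exp_zero, gaussConv_one]
  have hZ : effPartitionFn ℂ (hubbardCovAboveCT L M β μ h 0 Λ) 0 = 1 := by
    rw [effPartitionFn, hB, map_one]
  rw [hubbardEffectiveActionCT, hV, effAction, hZ, hB, Ring.inverse_one, one_smul, sub_self,
    grassmannLog1p_zero, neg_zero]

variable {L M}

/-- **Junk test (as requested): the certificate is FALSE at `U = 0`** (bare frame), for every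
chemical potential, physical data, accuracy, scale and volume threshold — the free effective action is
`0`, whose pairing strength `λ_d = 0` misses the window `[1/8, 1/5]`
(`not_symmetricCertifiedAt_zero`). [folklore] -/
theorem not_symmetricRegimeCertificate_free (μ : ℝ) (π : SymmetricRegimeData) (Θ : SymmetricAccuracy)
    (Λ : ℝ) (L₀ : ℕ) : ¬ symmetricRegimeCertificate 0 μ π Θ 0 Λ L₀ := by
  rintro ⟨-, -, -, h⟩
  haveI : NeZero (L₀ + 1) := ⟨Nat.succ_ne_zero _⟩
  obtain ⟨β₀, hβ₀⟩ := h (L₀ + 1) (Nat.le_succ _)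
  obtain ⟨M₀, hM₀⟩ := hβ₀ β₀ le_rfl
  haveI : NeZero (M₀ + 1) := ⟨Nat.succ_ne_zero _⟩
  have hc : SymmetricCertifiedAt π Θ Λ (L₀ + 1) (M₀ + 1) β₀ (nambuXiCT (L₀ + 1) μ 0)
      (hubbardEffectiveActionCT (L₀ + 1) (M₀ + 1) β₀ 0 μ 0 0 Λ)
      (hubbardEffPartitionFnCT (L₀ + 1) (M₀ + 1) β₀ 0 μ 0 0 Λ) := hM₀ (M₀ + 1) (Nat.le_succ _)
  rw [hubbardEffectiveActionCT_free_zero_frame] at hc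
  exact not_symmetricCertifiedAt_zero Λ (L₀ + 1) (M₀ + 1) β₀ _ _ hc

end Free

end Literature.MathematicalPhysics.QuantumLattice
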